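import Summits.FinalStateConjecture.FinalStateConjecture.Theorems.PhotonSphereChannelsWindowedShellChannelsGlueToolkit
import Summits.FinalStateConjecture.FinalStateConjecture.Theorems.PhotonSphereChannelsWindowedShellChannelsStubLostPSD

/-!
# Crux `WindowedShellChannels` (stmt-FinalStateConjecture-14085), line `Sketch` — glue core, part 1
# (interference bound for a separated pair in the far window)

The potential-independent heart of `stub_glue` (skeleton v8, lead c3).  For a differentiable `V ≥ 0`,
a window edge `a`, two finite-energy solutions `z` ("zone", data in `(−∞, Az)`) and `f` ("far", data in
`(Bf, ∞)`) whose supports have not met by the time `T` (`Az + T < Bf − T`), the weighted PSD-subadditivity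
of the windowed drop (`hD`, the registered `stub_dropPSD`) and a late-drop bound for `z` at time `T`
(`farEnergy V a z T ≤ farChannelEnergy V a z atTop + εE(z)`) give, for every later time `t ≥ T`,

  `farEnergy V a f t + farEnergy V a z t ≤ farEnergy V a (z + f) t + η·E(f) + (ε/η)·E(z)`

(`far_pair_lower`): interference between the two pieces in the far window costs only `ηE(f) + (ε/η)E(z)`.
Applied on the far side and on the reflected near side and combined with `LostPSD.lostPSD` for the small
gap piece, this yields the composition inequality `glue_core`.  No definitions. [folklore]
-/

noncomputable section

set_option linter.dupNamespace false

open Set Filter Topology Function MeasureTheory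
open scoped ENNReal

namespace Summit.FinalStateConjecture.FinalStateConjecture.Theorems.WindowedShellChannelsSketch

open Literature.Geometry.Lorentzian Literature.Geometry.Lorentzian.ReggeWheeler
open Summit.FinalStateConjecture.FinalStateConjecture.Theorems
open Summit.FinalStateConjecture.FinalStateConjecture.Theorems.CauchyWaveGlobal

namespace Glue

variable {V : ℝ → ℝ}

/-- Far energies of finite-energy solutions are finite at all times. [folklore] -/
theorem farEnergy_ne_top (hV : Differentiable ℝ V) (hV0 : ∀ x, 0 ≤ V x) {φ : ℝ → ℝ → ℝ}
    (hφ : IsSolution V φ) (hE : totalEnergy V φ 0 ≠ ⊤) (a t : ℝ) : farEnergy V a φ t ≠ ⊤ :=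
  ne_top_of_le_ne_top hE
    ((farEnergy_le_totalEnergy V a φ t).trans (RW.totalEnergy_le_totalEnergy hV hV0 hφ t 0))

/-- Far energies are bounded by the initial total energy. [folklore] -/
theorem farEnergy_le_totalEnergy_zero (hV : Differentiable ℝ V) (hV0 : ∀ x, 0 ≤ V x) {φ : ℝ → ℝ → ℝ}
    (hφ : IsSolution V φ) (a t : ℝ) : farEnergy V a φ t ≤ totalEnergy V φ 0 :=
  (farEnergy_le_totalEnergy V a φ t).trans (RW.totalEnergy_le_totalEnergy hV hV0 hφ t 0)

/-- The total energy of a sum of two finite-energy solutions is finite. [folklore] -/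
theorem totalEnergy_add_ne_top (hV : Differentiable ℝ V) (hV0 : ∀ x, 0 ≤ V x) {u v : ℝ → ℝ → ℝ}
    (hu : IsSolution V u) (hv : IsSolution V v) (hEu : totalEnergy V u 0 ≠ ⊤)
    (hEv : totalEnergy V v 0 ≠ ⊤) : totalEnergy V (fun t x => u t x + v t x) 0 ≠ ⊤ := by
  have h := LostPSD.setLIntegral_energyDensity_add_le hV hV0 hu.1 hv.1 one_pos 0 Set.univ
  simp only [Measure.restrict_univ] at h
  refine ne_top_of_le_ne_top ?_ h
  simp only [inv_one]
  exact ENNReal.add_ne_top.2 ⟨ENNReal.mul_ne_top ENNReal.ofReal_ne_top hEu,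
    ENNReal.mul_ne_top ENNReal.ofReal_ne_top hEv⟩

/-- **Interference bound for a separated pair in the far window.**  See the module docstring.
[folklore] -/
theorem far_pair_lower (hV : Differentiable ℝ V) (hV0 : ∀ x, 0 ≤ V x)
    (hD : ∀ (V : ℝ → ℝ), Differentiable ℝ V → (∀ x, 0 ≤ V x) →
      ∀ u v : ℝ → ℝ → ℝ, IsSolution V u → IsSolution V v → totalEnergy V u 0 ≠ ⊤ → totalEnergy V v 0 ≠ ⊤ →
      ∀ a η T t : ℝ, 0 < η → 0 ≤ T → T ≤ t →
        farEnergy V a (fun t x => u t x + v t x) T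
            + ENNReal.ofReal (1 + η) * farEnergy V a u t + ENNReal.ofReal (1 + η⁻¹) * farEnergy V a v t
          ≤ farEnergy V a (fun t x => u t x + v t x) t
            + ENNReal.ofReal (1 + η) * farEnergy V a u T + ENNReal.ofReal (1 + η⁻¹) * farEnergy V a v T)
    {z f : ℝ → ℝ → ℝ} (hz : IsSolution V z) (hf : IsSolution V f) (hEz : totalEnergy V z 0 ≠ ⊤)
    (hEf : totalEnergy V f 0 ≠ ⊤) {Az Bf a T : ℝ} (hsz : CauchyDataSupportedOn z (Iio Az))
    (hsf : CauchyDataSupportedOn f (Ioi Bf)) (hT : 0 ≤ T) (hsep : Az + T < Bf - T) {ε η : ℝ}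
    (hη : 0 < η) (hε : 0 ≤ ε)
    (hlate : farEnergy V a z T ≤ farChannelEnergy V a z atTop + ENNReal.ofReal ε * totalEnergy V z 0)
    {t : ℝ} (ht : T ≤ t) :
    farEnergy V a f t + farEnergy V a z t
      ≤ farEnergy V a (fun t x => z t x + f t x) t + ENNReal.ofReal η * totalEnergy V f 0
          + ENNReal.ofReal (ε / η) * totalEnergy V z 0 := by
  have ht0 : 0 ≤ t := hT.trans ht
  -- the registered drop inequality with `u = f` (weight 1+η) and `v = z` (weight 1+η⁻¹)
  have hfz : (fun t x => f t x + z t x) = fun t x => z t x + f t x := by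
    funext τ y; ring
  have hdrop := hD V hV hV0 f z hf hz hEf hEz a η T t hη hT ht
  rw [hfz] at hdrop
  -- additivity at the separation time `T`
  have hT' : Az + |T| < Bf - |T| := by rwa [abs_of_nonneg hT]
  have hadd : farEnergy V a (fun t x => z t x + f t x) T = farEnergy V a z T + farEnergy V a f T :=
    farEnergy_add_eq_of_separated hV hV0 hz hf hsz hsf a hT'
  rw [hadd] at hdrop
  -- finiteness
  have hzf : IsSolution V (fun t x => z t x + f t x) := by
    have h := isSolution_lincomb hz hf 1 1
    simp only [one_mul] at h
    exact h
  have hEzf : totalEnergy V (fun t x => z t x + f t x) 0 ≠ ⊤ := totalEnergy_add_ne_top hV hV0 hz hf hEz hEf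
  have hFz : ∀ τ, farEnergy V a z τ ≠ ⊤ := fun τ => farEnergy_ne_top hV hV0 hz hEz a τ
  have hFf : ∀ τ, farEnergy V a f τ ≠ ⊤ := fun τ => farEnergy_ne_top hV hV0 hf hEf a τ
  have hFzf : ∀ τ, farEnergy V a (fun t x => z t x + f t x) τ ≠ ⊤ := fun τ =>
    farEnergy_ne_top hV hV0 hzf hEzf a τ
  have hCz : farChannelEnergy V a z atTop ≠ ⊤ :=
    ne_top_of_le_ne_top (hFz 0) (farChannelEnergy_le_farEnergy hV.continuous hV0 hz a le_rfl)
  -- name the real numbers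
  set FzT := (farEnergy V a z T).toReal with hFzT
  set Fzt := (farEnergy V a z t).toReal with hFzt
  set FfT := (farEnergy V a f T).toReal with hFfT
  set Fft := (farEnergy V a f t).toReal with hFft
  set GT := (farEnergy V a (fun t x => z t x + f t x) T).toReal with hGT
  set Gt := (farEnergy V a (fun t x => z t x + f t x) t).toReal with hGt
  set Cz := (farChannelEnergy V a z atTop).toReal with hCz'
  set Ez := (totalEnergy V z 0).toReal with hEz'
  set Ef := (totalEnergy V f 0).toReal with hEf'
  have eFzT : farEnergy V a z T = ENNReal.ofReal FzT := (ENNReal.ofReal_toReal (hFz T)).symm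
  have eFzt : farEnergy V a z t = ENNReal.ofReal Fzt := (ENNReal.ofReal_toReal (hFz t)).symm
  have eFfT : farEnergy V a f T = ENNReal.ofReal FfT := (ENNReal.ofReal_toReal (hFf T)).symm
  have eFft : farEnergy V a f t = ENNReal.ofReal Fft := (ENNReal.ofReal_toReal (hFf t)).symm
  have eGt : farEnergy V a (fun t x => z t x + f t x) t = ENNReal.ofReal Gt :=
    (ENNReal.ofReal_toReal (hFzf t)).symm
  have eCz : farChannelEnergy V a z atTop = ENNReal.ofReal Cz := (ENNReal.ofReal_toReal hCz).symm
  have eEz : totalEnergy V z 0 = ENNReal.ofReal Ez := (ENNReal.ofReal_toReal hEz).symm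
  have eEf : totalEnergy V f 0 = ENNReal.ofReal Ef := (ENNReal.ofReal_toReal hEf).symm
  have n0 : 0 ≤ FzT := ENNReal.toReal_nonneg
  have n1 : 0 ≤ Fzt := ENNReal.toReal_nonneg
  have n2 : 0 ≤ FfT := ENNReal.toReal_nonneg
  have n3 : 0 ≤ Fft := ENNReal.toReal_nonneg
  have n5 : 0 ≤ Gt := ENNReal.toReal_nonneg
  have n6 : 0 ≤ Cz := ENNReal.toReal_nonneg
  have n7 : 0 ≤ Ez := ENNReal.toReal_nonneg
  have n8 : 0 ≤ Ef := ENNReal.toReal_nonneg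
  have hη1 : 0 ≤ 1 + η := by linarith
  have hη2 : 0 ≤ 1 + η⁻¹ := by positivity
  -- the drop inequality in reals
  have hdrop' : FzT + FfT + (1 + η) * Fft + (1 + η⁻¹) * Fzt ≤ Gt + (1 + η) * FfT + (1 + η⁻¹) * FzT := by
    have h := hdrop
    rw [eFzT, eFfT, eFft, eFzt, eGt, ← ENNReal.ofReal_add n0 n2, ← ENNReal.ofReal_mul hη1,
      ← ENNReal.ofReal_mul hη2, ← ENNReal.ofReal_mul hη1, ← ENNReal.ofReal_mul hη2,
      ← ENNReal.ofReal_add (by positivity) (by positivity),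
      ← ENNReal.ofReal_add (by positivity) (by positivity),
      ← ENNReal.ofReal_add (by positivity) (by positivity),
      ← ENNReal.ofReal_add (by positivity) (by positivity),
      ENNReal.ofReal_le_ofReal_iff (by positivity)] at h
    exact h
  -- the late-drop bound and the channel bound in reals
  have hlate' : FzT ≤ Cz + ε * Ez := by
    have h := hlate
    rw [eFzT, eCz, eEz, ← ENNReal.ofReal_mul hε, ← ENNReal.ofReal_add n6 (by positivity),
      ENNReal.ofReal_le_ofReal_iff (by positivity)] at h
    exact h
  have hch : Cz ≤ Fzt := by
    have h := farChannelEnergy_le_farEnergy hV.continuous hV0 hz a ht0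
    rw [eCz, eFzt, ENNReal.ofReal_le_ofReal_iff n1] at h
    exact h
  have hFfE : FfT ≤ Ef := by
    have h := farEnergy_le_totalEnergy_zero hV hV0 hf a T
    rw [eFfT, eEf, ENNReal.ofReal_le_ofReal_iff n8] at h
    exact h
  -- combine: Fft + Fzt ≤ Gt + η (FfT − Fft) + η⁻¹ (FzT − Fzt) ≤ Gt + η Ef + (ε/η) Ez
  have key : Fft + Fzt ≤ Gt + η * Ef + ε / η * Ez := by
    have h1 : Fft + Fzt ≤ Gt + η * (FfT - Fft) + η⁻¹ * (FzT - Fzt) := by nlinarith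
    have h2 : η * (FfT - Fft) ≤ η * Ef := by
      apply mul_le_mul_of_nonneg_left _ hη.le; linarith
    have h3 : η⁻¹ * (FzT - Fzt) ≤ ε / η * Ez := by
      rw [div_eq_mul_inv, mul_comm ε, mul_assoc]
      apply mul_le_mul_of_nonneg_left _ (by positivity); linarith
    linarith
  -- back to `ℝ≥0∞`
  rw [eFft, eFzt, eGt, eEf, eEz, ← ENNReal.ofReal_add n3 n1, ← ENNReal.ofReal_mul hη.le,
    ← ENNReal.ofReal_mul (by positivity), ← ENNReal.ofReal_add n5 (by positivity),
    ← ENNReal.ofReal_add (by positivity) (by positivity)]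
  exact ENNReal.ofReal_le_ofReal key

/-- Cauchy data supported in `(B, ∞)` reflect to Cauchy data supported in `(−∞, −B)`. [folklore] -/
theorem supported_reflect_Ioi {ψ : ℝ → ℝ → ℝ} {B : ℝ} (h : CauchyDataSupportedOn ψ (Ioi B)) :
    CauchyDataSupportedOn (fun t x => ψ t (-x)) (Iio (-B)) := by
  intro x hx
  have hx' : -x ∉ Ioi B := by
    simp only [mem_Ioi, not_lt]
    simp only [mem_Iio, not_lt] at hx
    linarith
  exact h (-x) hx'

/-- The Cauchy data of a sum of two `C²` functions supported in `S` are supported in `S`. [folklore] -/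
theorem supported_add {u v : ℝ → ℝ → ℝ} (hu : ContDiff ℝ 2 (uncurry u)) (hv : ContDiff ℝ 2 (uncurry v))
    {S : Set ℝ} (hsu : CauchyDataSupportedOn u S) (hsv : CauchyDataSupportedOn v S) :
    CauchyDataSupportedOn (fun t x => u t x + v t x) S := by
  intro x hx
  obtain ⟨hu0, hu1⟩ := hsu x hx
  obtain ⟨hv0, hv1⟩ := hsv x hx
  refine ⟨by simp only [hu0, hv0, add_zero], ?_⟩
  have h := deriv_lincomb_fst hu hv 1 1 0 x
  simp only [one_mul] at h
  rw [h, hu1, hv1]; ring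

end Glue

/-- **Registered principal statement of this file** (`glueCore_addFinite`): the total energy of a sum
of two finite-energy global solutions is finite. [folklore] -/
theorem glueCore_addFinite : ∀ (V : ℝ → ℝ), Differentiable ℝ V → (∀ x, 0 ≤ V x) →
    ∀ u v : ℝ → ℝ → ℝ, IsSolution V u → IsSolution V v → totalEnergy V u 0 ≠ ⊤ → totalEnergy V v 0 ≠ ⊤ →
      totalEnergy V (fun t x => u t x + v t x) 0 ≠ ⊤ :=
  fun _ hV hV0 _ _ hu hv hEu hEv => Glue.totalEnergy_add_ne_top hV hV0 hu hv hEu hEv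

end Summit.FinalStateConjecture.FinalStateConjecture.Theorems.WindowedShellChannelsSketch

end
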